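import Mathlib
import Literature.NumberTheory.LFunctions.ProlateFrobenius
import HarnessLib

/-!
# The principal Frobenius solution: small and large parameters

THIS IS NOT AN RH STATEMENT.  For the principal solution `u_χ = frobSol λ χ` of the prolate equation
(normalised by `u_χ(λ) = 1`) we prove the two "end" facts of the shooting argument on `[0, λ]`:

* `frobSol_pos_of_nonpos`, `frobSol₁_zero_neg_of_nonpos`: for `χ ≤ 0`, `u_χ > 0` on `[0, λ]` and
  `u_χ′(0) < 0` (the flux `(λ² − x²) u_χ′` is increasing and vanishes at `λ`);
* `le_ncard_zeros_frobSol`: for `χ > 4π²λ⁴ + 4m²π²`, `u_χ` has at least `m` zeros in `(0, λ)`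
  (Sturm–Picone comparison with `sin(2mπx/λ)` on the gaps `[(2j+1)λ/(2m), (2j+2)λ/(2m)]`).

References: [Hartman 2002, Ch. XI §3 (Picone identity)]; [Coddington–Levinson 1955, Ch. 8 §1];
[Slepian–Pollak 1961, §III].
-/

noncomputable section

open Real Set Filter Topology

namespace Literature.NumberTheory.LFunctions

variable {lam χ : ℝ}

/-- On `[0, λ]` the Frobenius series converges: `|λ − x| < 2λ`. [folklore] -/
theorem abs_sub_lt_two_mul_of_mem_Icc (hlam : 0 < lam) {x : ℝ} (hx : x ∈ Icc 0 lam) :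
    |lam - x| < 2 * lam := by
  rw [abs_of_nonneg (by linarith [hx.2])]
  linarith [hx.1]

/-- The flux form of the equation for `frobSol`: `((λ² − x²) u′)′ = ((2πλx)² − χ) u`.
[cite: ConnesConsaniMoscovici2025, §7 eq. (7.5)] -/
theorem hasDerivAt_frobFlux (hlam : 0 < lam) (χ : ℝ) {x : ℝ} (hx : |lam - x| < 2 * lam) :
    HasDerivAt (fun y ↦ (lam ^ 2 - y ^ 2) * frobSol₁ lam χ y)
      (((2 * π * lam * x) ^ 2 - χ) * frobSol lam χ x) x := by
  have hp : HasDerivAt (fun y : ℝ ↦ lam ^ 2 - y ^ 2) (-(2 * x)) x := by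
    simpa using (hasDerivAt_pow 2 x).const_sub (lam ^ 2)
  refine (hp.mul (hasDerivAt_frobSol₁ hlam χ hx)).congr_deriv ?_
  linear_combination frobSol_ode hlam χ hx

/-! ### Non-positive parameters -/

/-- For `χ ≤ 0` the principal solution is positive on `[0, λ]`.
[cite: SlepianPollak1961, §III; Hartman2002, Ch. XI §6] -/
theorem frobSol_pos_of_nonpos (hlam : 0 < lam) (hχ : χ ≤ 0) :
    ∀ x ∈ Icc 0 lam, 0 < frobSol lam χ x := by
  have hI := fun x (hx : x ∈ Icc 0 lam) ↦ abs_sub_lt_two_mul_of_mem_Icc hlam hx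
  have hcont : ContinuousOn (frobSol lam χ) (Icc 0 lam) :=
    fun x hx ↦ (hasDerivAt_frobSol hlam χ (hI x hx)).continuousAt.continuousWithinAt
  by_contra hcon
  push Not at hcon
  obtain ⟨x₁, hx₁, hux₁⟩ := hcon
  set Z : Set ℝ := Icc 0 lam ∩ frobSol lam χ ⁻¹' Iic 0 with hZ
  have hZcl : IsClosed Z := hcont.preimage_isClosed_of_isClosed isClosed_Icc isClosed_Iic
  have hZc : IsCompact Z := isCompact_Icc.of_isClosed_subset hZcl inter_subset_left
  have hZne : Z.Nonempty := ⟨x₁, hx₁, hux₁⟩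
  set x₀ := sSup Z with hx₀
  have hx₀Z : x₀ ∈ Z := hZc.sSup_mem hZne
  have hle : ∀ y ∈ Z, y ≤ x₀ := fun y hy ↦ le_csSup hZc.bddAbove hy
  have hux₀ : frobSol lam χ x₀ ≤ 0 := hx₀Z.2
  have hx₀lam : x₀ < lam := by
    rcases hx₀Z.1.2.eq_or_lt with h | h
    · rw [h, frobSol_self] at hux₀; linarith
    · exact h
  have hpos : ∀ y ∈ Ioc x₀ lam, 0 < frobSol lam χ y := by
    intro y hy
    by_contra h
    push Not at h
    have := hle y ⟨⟨hx₀Z.1.1.trans hy.1.le, hy.2⟩, h⟩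
    linarith [hy.1]
  have hsub : Icc x₀ lam ⊆ Icc 0 lam := Icc_subset_Icc hx₀Z.1.1 le_rfl
  -- the flux is monotone on `[x₀, λ]`
  set Φ : ℝ → ℝ := fun y ↦ (lam ^ 2 - y ^ 2) * frobSol₁ lam χ y with hΦ
  have hΦd : ∀ y ∈ Icc 0 lam,
      HasDerivAt Φ (((2 * π * lam * y) ^ 2 - χ) * frobSol lam χ y) y :=
    fun y hy ↦ hasDerivAt_frobFlux hlam χ (hI y hy)
  have hΦmono : MonotoneOn Φ (Icc x₀ lam) := by
    refine monotoneOn_of_deriv_nonneg (convex_Icc _ _)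
      (fun y hy ↦ (hΦd y (hsub hy)).continuousAt.continuousWithinAt)
      (fun y hy ↦ (hΦd y (hsub (interior_subset hy))).differentiableAt.differentiableWithinAt)
      fun y hy ↦ ?_
    rw [interior_Icc] at hy
    rw [(hΦd y (hsub (Ioo_subset_Icc_self hy))).deriv]
    exact mul_nonneg (by nlinarith [sq_nonneg (2 * π * lam * y)]) (hpos y ⟨hy.1, hy.2.le⟩).le
  have hΦlam : Φ lam = 0 := by simp [hΦ]
  have hu₁ : ∀ y ∈ Ioo x₀ lam, frobSol₁ lam χ y ≤ 0 := by
    intro y hy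
    have h1 : Φ y ≤ Φ lam := hΦmono ⟨hy.1.le, hy.2.le⟩ ⟨hx₀lam.le, le_rfl⟩ hy.2.le
    rw [hΦlam] at h1
    have hp : 0 < lam ^ 2 - y ^ 2 := by nlinarith [hx₀Z.1.1, hy.1, hy.2]
    by_contra h
    push Not at h
    have : 0 < Φ y := mul_pos hp h
    linarith
  -- hence `u` is antitone on `[x₀, λ]`, contradiction
  have hanti : AntitoneOn (frobSol lam χ) (Icc x₀ lam) := by
    refine antitoneOn_of_deriv_nonpos (convex_Icc _ _) (hcont.mono hsub)
      (fun y hy ↦ (hasDerivAt_frobSol hlam χ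
        (hI y (hsub (interior_subset hy)))).differentiableAt.differentiableWithinAt)
      fun y hy ↦ ?_
    rw [interior_Icc] at hy
    rw [(hasDerivAt_frobSol hlam χ (hI y (hsub (Ioo_subset_Icc_self hy)))).deriv]
    exact hu₁ y hy
  have := hanti ⟨le_rfl, hx₀lam.le⟩ ⟨hx₀lam.le, le_rfl⟩ hx₀lam.le
  rw [frobSol_self] at this
  linarith

/-- For `χ ≤ 0` the principal solution has negative slope at `0`.
[cite: SlepianPollak1961, §III; Hartman2002, Ch. XI §6] -/
theorem frobSol₁_zero_neg_of_nonpos (hlam : 0 < lam) (hχ : χ ≤ 0) : frobSol₁ lam χ 0 < 0 := by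
  have hI := fun x (hx : x ∈ Icc 0 lam) ↦ abs_sub_lt_two_mul_of_mem_Icc hlam hx
  have hpos := frobSol_pos_of_nonpos hlam hχ
  set Φ : ℝ → ℝ := fun y ↦ (lam ^ 2 - y ^ 2) * frobSol₁ lam χ y with hΦ
  have hΦd : ∀ y ∈ Icc 0 lam,
      HasDerivAt Φ (((2 * π * lam * y) ^ 2 - χ) * frobSol lam χ y) y :=
    fun y hy ↦ hasDerivAt_frobFlux hlam χ (hI y hy)
  have hΦmono : StrictMonoOn Φ (Icc 0 lam) := by
    refine strictMonoOn_of_deriv_pos (convex_Icc _ _)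
      (fun y hy ↦ (hΦd y hy).continuousAt.continuousWithinAt) fun y hy ↦ ?_
    rw [interior_Icc] at hy
    rw [(hΦd y (Ioo_subset_Icc_self hy)).deriv]
    refine mul_pos ?_ (hpos y (Ioo_subset_Icc_self hy))
    have : 0 < (2 * π * lam * y) ^ 2 := by
      have : 0 < 2 * π * lam * y := by have := hy.1; positivity
      positivity
    linarith
  have h := hΦmono ⟨le_rfl, hlam.le⟩ ⟨hlam.le, le_rfl⟩ hlam
  have hΦlam : Φ lam = 0 := by simp [hΦ]
  have hΦ0 : Φ 0 = lam ^ 2 * frobSol₁ lam χ 0 := by simp [hΦ]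
  rw [hΦlam, hΦ0] at h
  by_contra hcon
  push Not at hcon
  have : 0 ≤ lam ^ 2 * frobSol₁ lam χ 0 := mul_nonneg (sq_nonneg _) hcon
  linarith

/-! ### Large parameters: Sturm–Picone comparison with a sine -/

/-- **Picone comparison on one gap.**  Let `u` solve the prolate equation (flux form, parameter `χ`)
on `[α, β] ⊆ [0, λ]`, and let `sin(ωx)` vanish at `α`, `β` and nowhere in between, with
`4π²λ⁴ + λ²ω² < χ`.  Then `u` has a zero in `[α, β]`: otherwise the Picone function
`Ψ = sin²(ωx)(λ²−x²)u′/u − λ²ω sin(ωx)cos(ωx)` would be strictly decreasing on `[α, β]` with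
`Ψ(α) = Ψ(β) = 0`. [cite: Hartman2002, Ch. XI §3 (Picone identity); CoddingtonLevinson1955, Ch. 8 §1 Thm 1.1] -/
theorem picone_gap {lam χ ω α β : ℝ} {u u₁ : ℝ → ℝ} (hα : 0 ≤ α) (hαβ : α < β) (hβ : β ≤ lam)
    (hχ : 4 * π ^ 2 * lam ^ 4 + lam ^ 2 * ω ^ 2 < χ)
    (hu : ∀ x ∈ Icc α β, HasDerivAt u (u₁ x) x)
    (hflux : ∀ x ∈ Icc α β,
      HasDerivAt (fun y ↦ (lam ^ 2 - y ^ 2) * u₁ y) (((2 * π * lam * x) ^ 2 - χ) * u x) x)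
    (hvα : sin (ω * α) = 0) (hvβ : sin (ω * β) = 0) (hv : ∀ x ∈ Ioo α β, sin (ω * x) ≠ 0) :
    ∃ x ∈ Icc α β, u x = 0 := by
  by_contra hcon
  push Not at hcon
  set Ψ : ℝ → ℝ := fun x ↦ sin (ω * x) * sin (ω * x) * ((lam ^ 2 - x ^ 2) * u₁ x) / u x
    - lam ^ 2 * ω * (sin (ω * x) * cos (ω * x)) with hΨ
  -- the derivative of `Ψ`
  set E : ℝ → ℝ := fun x ↦
    -(lam ^ 2 - x ^ 2) * (sin (ω * x) * u₁ x / u x - ω * cos (ω * x)) ^ 2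
      - x ^ 2 * (ω * cos (ω * x)) ^ 2
      - (χ - (2 * π * lam * x) ^ 2 - lam ^ 2 * ω ^ 2) * sin (ω * x) ^ 2 with hE
  have hΨd : ∀ x ∈ Icc α β, HasDerivAt Ψ (E x) x := by
    intro x hx
    have hux : u x ≠ 0 := hcon x hx
    have hωx : HasDerivAt (fun y : ℝ ↦ ω * y) ω x := by
      simpa using (hasDerivAt_id x).const_mul ω
    have hs : HasDerivAt (fun y ↦ sin (ω * y)) (cos (ω * x) * ω) x := hωx.sin
    have hc : HasDerivAt (fun y ↦ cos (ω * y)) (-sin (ω * x) * ω) x := hωx.cos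
    have h1 := (((hs.mul hs).mul (hflux x hx)).div (hu x hx) hux).sub
      ((hs.mul hc).const_mul (lam ^ 2 * ω))
    refine h1.congr_deriv ?_
    simp only [hE, Pi.mul_apply]
    field_simp
    ring
  have hΨc : ContinuousOn Ψ (Icc α β) := fun x hx ↦ (hΨd x hx).continuousAt.continuousWithinAt
  have hEneg : ∀ x ∈ Ioo α β, E x < 0 := by
    intro x hx
    have hp : 0 ≤ lam ^ 2 - x ^ 2 := by nlinarith [hx.1, hx.2]
    have hq : (2 * π * lam * x) ^ 2 ≤ 4 * π ^ 2 * lam ^ 4 := by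
      have h0x : 0 ≤ x := hα.trans hx.1.le
      have hxl : x ≤ lam := hx.2.le.trans hβ
      have hx2 : x ^ 2 ≤ lam ^ 2 := pow_le_pow_left₀ h0x hxl 2
      calc (2 * π * lam * x) ^ 2 = 4 * π ^ 2 * lam ^ 2 * x ^ 2 := by ring
        _ ≤ 4 * π ^ 2 * lam ^ 2 * lam ^ 2 := mul_le_mul_of_nonneg_left hx2 (by positivity)
        _ = 4 * π ^ 2 * lam ^ 4 := by ring
    have hs2 : 0 < sin (ω * x) ^ 2 := by
      have := hv x hx
      positivity
    have h3 : 0 < (χ - (2 * π * lam * x) ^ 2 - lam ^ 2 * ω ^ 2) * sin (ω * x) ^ 2 :=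
      mul_pos (by linarith) hs2
    have h1 : 0 ≤ (lam ^ 2 - x ^ 2) * (sin (ω * x) * u₁ x / u x - ω * cos (ω * x)) ^ 2 :=
      mul_nonneg hp (sq_nonneg _)
    have h2 : 0 ≤ x ^ 2 * (ω * cos (ω * x)) ^ 2 := mul_nonneg (sq_nonneg _) (sq_nonneg _)
    simp only [hE]
    linarith
  have hanti : StrictAntiOn Ψ (Icc α β) := by
    refine strictAntiOn_of_deriv_neg (convex_Icc _ _) hΨc fun x hx ↦ ?_
    rw [interior_Icc] at hx
    rw [(hΨd x (Ioo_subset_Icc_self hx)).deriv]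
    exact hEneg x hx
  have h := hanti ⟨le_rfl, hαβ.le⟩ ⟨hαβ.le, le_rfl⟩ hαβ
  have hΨα : Ψ α = 0 := by simp [hΨ, hvα]
  have hΨβ : Ψ β = 0 := by simp [hΨ, hvβ]
  rw [hΨα, hΨβ] at h
  exact lt_irrefl _ h

/-- `sin y ≠ 0` strictly between consecutive multiples of `π`. [folklore] -/
theorem sin_ne_zero_of_mem_Ioo_mul_pi {y : ℝ} {k : ℕ} (hy : y ∈ Ioo ((k : ℝ) * π) (((k : ℝ) + 1) * π)) :
    sin y ≠ 0 := by
  intro h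
  obtain ⟨n, hn⟩ := Real.sin_eq_zero_iff.mp h
  rw [← hn] at hy
  have h1 : (k : ℝ) < n := lt_of_mul_lt_mul_right hy.1 pi_pos.le
  have h2 : (n : ℝ) < k + 1 := lt_of_mul_lt_mul_right hy.2 pi_pos.le
  have h1' : (k : ℤ) < n := by exact_mod_cast h1
  have h2' : n < (k : ℤ) + 1 := by exact_mod_cast h2
  omega

/-- **Many zeros for large parameters.**  If `χ > 4π²λ⁴ + 4m²π²` then the principal solution `u_χ` has
at least `m` zeros in `(0, λ)` (given that it has finitely many): one in each of the `m` disjoint gaps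
`[(2j+1)λ/(2m), (2j+2)λ/(2m)]` of `sin(2mπx/λ)`.
[cite: Hartman2002, Ch. XI §3; SlepianPollak1961, §III] -/
theorem le_ncard_zeros_frobSol (hlam : 0 < lam) (m : ℕ)
    (hχ : 4 * π ^ 2 * lam ^ 4 + 4 * (m : ℝ) ^ 2 * π ^ 2 < χ)
    (hfin : {x | x ∈ Ioo 0 lam ∧ frobSol lam χ x = 0}.Finite) :
    m ≤ {x | x ∈ Ioo 0 lam ∧ frobSol lam χ x = 0}.ncard := by
  rcases Nat.eq_zero_or_pos m with rfl | hm
  · exact Nat.zero_le _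
  have hmR : (0 : ℝ) < m := by exact_mod_cast hm
  have hI := fun x (hx : x ∈ Icc 0 lam) ↦ abs_sub_lt_two_mul_of_mem_Icc hlam hx
  set ω : ℝ := 2 * m * π / lam with hω
  have hωpos : 0 < ω := by rw [hω]; positivity
  have hχ' : 4 * π ^ 2 * lam ^ 4 + lam ^ 2 * ω ^ 2 < χ := by
    have : lam ^ 2 * ω ^ 2 = 4 * (m : ℝ) ^ 2 * π ^ 2 := by
      rw [hω]; field_simp; ring
    linarith
  -- the gaps
  set α : ℕ → ℝ := fun j ↦ (2 * (j : ℝ) + 1) * lam / (2 * m) with hαdef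
  set β : ℕ → ℝ := fun j ↦ (2 * (j : ℝ) + 2) * lam / (2 * m) with hβdef
  have hωα : ∀ j : ℕ, ω * α j = ((2 * j + 1 : ℕ) : ℝ) * π := by
    intro j; simp only [hω, hαdef]; push_cast; field_simp
  have hωβ : ∀ j : ℕ, ω * β j = ((2 * j + 2 : ℕ) : ℝ) * π := by
    intro j; simp only [hω, hβdef]; push_cast; field_simp
  have hαpos : ∀ j : ℕ, 0 < α j := fun j ↦ by simp only [hαdef]; positivity
  have hαβ : ∀ j : ℕ, α j < β j := by
    intro j; simp only [hαdef, hβdef]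
    exact div_lt_div_of_pos_right (by nlinarith) (by positivity)
  have hβle : ∀ j : ℕ, j < m → β j ≤ lam := by
    intro j hj
    simp only [hβdef]
    rw [div_le_iff₀ (by positivity)]
    have : (2 * (j : ℝ) + 2) ≤ 2 * m := by
      have : (j : ℝ) + 1 ≤ m := by exact_mod_cast hj
      linarith
    nlinarith
  have hβα : ∀ j j' : ℕ, j < j' → β j < α j' := by
    intro j j' hjj'
    simp only [hαdef, hβdef]
    refine div_lt_div_of_pos_right ?_ (by positivity)
    have : (j : ℝ) + 1 ≤ j' := by exact_mod_cast hjj'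
    nlinarith
  -- a zero in each gap
  have hex : ∀ j ∈ (Finset.range m : Set ℕ), ∃ x, x ∈ Icc (α j) (β j) ∧ frobSol lam χ x = 0 := by
    intro j hj
    have hj : j < m := by simpa using hj
    have hsub : Icc (α j) (β j) ⊆ Icc 0 lam := Icc_subset_Icc (hαpos j).le (hβle j hj)
    obtain ⟨x, hx, hux⟩ := picone_gap (u := frobSol lam χ) (u₁ := frobSol₁ lam χ) (hαpos j).le
      (hαβ j) (hβle j hj) hχ' (fun x hx ↦ hasDerivAt_frobSol hlam χ (hI x (hsub hx)))
      (fun x hx ↦ hasDerivAt_frobFlux hlam χ (hI x (hsub hx)))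
      (by rw [hωα]; exact sin_nat_mul_pi _) (by rw [hωβ]; exact sin_nat_mul_pi _)
      (by
        intro x hx
        apply sin_ne_zero_of_mem_Ioo_mul_pi (k := 2 * j + 1)
        constructor
        · have := mul_lt_mul_of_pos_left hx.1 hωpos
          rw [hωα] at this
          exact_mod_cast this
        · have := mul_lt_mul_of_pos_left hx.2 hωpos
          rw [hωβ] at this
          push_cast at this ⊢
          linarith)
    exact ⟨x, hx, hux⟩
  choose! xz hxz using hex
  have hmaps : ∀ j ∈ (Finset.range m : Set ℕ), xz j ∈ {x | x ∈ Ioo 0 lam ∧ frobSol lam χ x = 0} := by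
    intro j hj
    have hj' : j < m := by simpa using hj
    obtain ⟨hx, hux⟩ := hxz j hj
    refine ⟨⟨lt_of_lt_of_le (hαpos j) hx.1, lt_of_le_of_ne (hx.2.trans (hβle j hj')) ?_⟩, hux⟩
    intro h
    rw [h, frobSol_self] at hux
    exact one_ne_zero hux
  have hinj : InjOn xz (Finset.range m : Set ℕ) := by
    have hlt : ∀ j ∈ (Finset.range m : Set ℕ), ∀ j' ∈ (Finset.range m : Set ℕ), j < j' →
        xz j < xz j' := by
      intro j hj j' hj' hjj'
      have h1 := (hxz j hj).1.2
      have h2 := (hxz j' hj').1.1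
      linarith [hβα j j' hjj']
    intro j hj j' hj' h
    by_contra hne
    rcases lt_or_gt_of_ne hne with h' | h'
    · exact absurd h (hlt j hj j' hj' h').ne
    · exact absurd h (hlt j' hj' j hj h').ne'
  have := ncard_le_ncard_of_injOn xz hmaps hinj hfin
  rwa [ncard_coe_finset, Finset.card_range] at this

end Literature.NumberTheory.LFunctions
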